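import Literature.AlgebraicGeometry.Shioda1982.ExceptionalQuadruplesComplete
import HarnessLib

/-!
# Shioda 1982 / Meyer–Neutsch 1981: no exceptional quadruple at the level `N = 560` — kernel sweep, part 1 of 21

Topic `Literature/AlgebraicGeometry/Shioda1982`; companion of `ExceptionalQuadruplesComplete.lean` (search `checkB`, soundness
`tabelleOneCompleteAt_of_chunks`, invariant form `exists_mem_reps_of_isExceptionalQuadruple`, statement `TabelleOneCompleteAt`; sources,
method and framing in its module docstring) and of the series `ExceptionalQuadruplesSweep*.lean` (together: every level `2 ≤ N ≤ 180`
that is not a row of Tabelle 1; `…SweepTwoHundredTwenty/…TwoHundredSixty/…ThreeHundredForty.lean`,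
`…SweepTwoHundredFiftyTwo/…ThreeHundredNinetySix/…FourHundredSixtyEight.lean`, `…SweepTwoHundred.lean`: the levels `220, 260, 340`, `252, 396, 468`
and `200` of the families `20p`, `36p`, `40p`; `…Sweep<Level>[Part<K>].lean` for the `{2,3,5,7}`-smooth residual levels
`189, 192, 210, 216, 224, 240, 270, 288, 300, 315, 320, 324, 336, 360, 378, 384, 405, 420, 432, 448` and now `480 … 630`). THEOREMS only (no definition, no named fact): the same kernel
search at the single level `N = 560`, which carries NO row of [MeyerNeutsch1981Fermatquadrupel, Tabelle 1] (computer-generated there,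
"alle Fermatquadrupel für N ≤ 614 ermittelt", §2 p. 53) and lies above the range `N ≤ 180` of Shioda's table p. 727 — by Aoki's
Theorem C ([Aoki1983], computer-assisted for `181 ≤ m ≤ 672`) there is no exceptional element at any level `> 180`; the files
`ExceptionalQuadruplesSweepFiveHundredSixtyPartOne.lean`, `ExceptionalQuadruplesSweepFiveHundredSixtyPartTwo.lean`, `ExceptionalQuadruplesSweepFiveHundredSixtyPartThree.lean`, `ExceptionalQuadruplesSweepFiveHundredSixtyPartFour.lean`, `ExceptionalQuadruplesSweepFiveHundredSixtyPartFive.lean`, `ExceptionalQuadruplesSweepFiveHundredSixtyPartSix.lean`, `ExceptionalQuadruplesSweepFiveHundredSixtyPartSeven.lean`, `ExceptionalQuadruplesSweepFiveHundredSixtyPartEight.lean`, `ExceptionalQuadruplesSweepFiveHundredSixtyPartNine.lean`, `ExceptionalQuadruplesSweepFiveHundredSixtyPartTen.lean`, `ExceptionalQuadruplesSweepFiveHundredSixtyPartEleven.lean`, `ExceptionalQuadruplesSweepFiveHundredSixtyPartTwelve.lean`, `ExceptionalQuadruplesSweepFiveHundredSixtyPartThirteen.lean`, `ExceptionalQuadruplesSweepFiveHundredSixtyPartFourteen.lean`,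 `ExceptionalQuadruplesSweepFiveHundredSixtyPartFifteen.lean`, `ExceptionalQuadruplesSweepFiveHundredSixtyPartSixteen.lean`, `ExceptionalQuadruplesSweepFiveHundredSixtyPartSeventeen.lean`, `ExceptionalQuadruplesSweepFiveHundredSixtyPartEighteen.lean`, `ExceptionalQuadruplesSweepFiveHundredSixtyPartNineteen.lean`, `ExceptionalQuadruplesSweepFiveHundredSixtyPartTwenty.lean`, `ExceptionalQuadruplesSweepFiveHundredSixty.lean` make the instance `N = 560` a kernel statement. The search at
`N = 560` visits 4917469 candidate triples (`φ(560) − 1 = 191` units each), too many for one elaboration of bounded wall time, so the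
chunks of first entries are spread over 21 files: `ExceptionalQuadruplesSweepFiveHundredSixtyPartOne.lean` — first entries `0 ≤ a < 8` (211579 candidates);
`ExceptionalQuadruplesSweepFiveHundredSixtyPartTwo.lean` — first entries `8 ≤ a < 17` (244144 candidates);
`ExceptionalQuadruplesSweepFiveHundredSixtyPartThree.lean` — first entries `17 ≤ a < 25` (221416 candidates);
`ExceptionalQuadruplesSweepFiveHundredSixtyPartFour.lean` — first entries `25 ≤ a < 34` (252827 candidates);
`ExceptionalQuadruplesSweepFiveHundredSixtyPartFive.lean` — first entries `34 ≤ a < 42` (227015 candidates);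
`ExceptionalQuadruplesSweepFiveHundredSixtyPartSix.lean` — first entries `42 ≤ a < 50` (228183 candidates);
`ExceptionalQuadruplesSweepFiveHundredSixtyPartSeven.lean` — first entries `50 ≤ a < 58` (228412 candidates);
`ExceptionalQuadruplesSweepFiveHundredSixtyPartEight.lean` — first entries `58 ≤ a < 67` (256069 candidates);
`ExceptionalQuadruplesSweepFiveHundredSixtyPartNine.lean` — first entries `67 ≤ a < 75` (225783 candidates);
`ExceptionalQuadruplesSweepFiveHundredSixtyPartTen.lean` — first entries `75 ≤ a < 83` (223079 candidates);
`ExceptionalQuadruplesSweepFiveHundredSixtyPartEleven.lean` — first entries `83 ≤ a < 92` (246563 candidates);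
`ExceptionalQuadruplesSweepFiveHundredSixtyPartTwelve.lean` — first entries `92 ≤ a < 101` (240616 candidates);
`ExceptionalQuadruplesSweepFiveHundredSixtyPartThirteen.lean` — first entries `101 ≤ a < 110` (233333 candidates);
`ExceptionalQuadruplesSweepFiveHundredSixtyPartFourteen.lean` — first entries `110 ≤ a < 119` (224713 candidates);
`ExceptionalQuadruplesSweepFiveHundredSixtyPartFifteen.lean` — first entries `119 ≤ a < 129` (237946 candidates);
`ExceptionalQuadruplesSweepFiveHundredSixtyPartSixteen.lean` — first entries `129 ≤ a < 139` (223821 candidates);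
`ExceptionalQuadruplesSweepFiveHundredSixtyPartSeventeen.lean` — first entries `139 ≤ a < 151` (247359 candidates);
`ExceptionalQuadruplesSweepFiveHundredSixtyPartEighteen.lean` — first entries `151 ≤ a < 164` (238366 candidates);
`ExceptionalQuadruplesSweepFiveHundredSixtyPartNineteen.lean` — first entries `164 ≤ a < 179` (231643 candidates);
`ExceptionalQuadruplesSweepFiveHundredSixtyPartTwenty.lean` — first entries `179 ≤ a < 199` (227308 candidates);
`ExceptionalQuadruplesSweepFiveHundredSixty.lean` — first entries `199 ≤ a < 560` (247294 candidates); the last one assembles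
`completeAt_fiveHundredSixty` (every sorted pair-free primitive Hodge 4-multiset mod `560` is standard) and `not_isExceptionalQuadruple_fiveHundredSixty`.
WHY THIS LEVEL (cell `pub-hfermat`): `560 = 2⁴·5·7`: the tree's character-sum families cover the levels `K·p`, `p` a prime above a bound depending on `K`, for
`K ∈ {2, 3, 4, 6, 8, 9, 10, 12, 18, 20, 24, 36, 40}` or `K` a power of `2` or of `3` (`PicardNumber<K>Prime.lean`, `PicardNumberTwoPowerPrime.lean`,
`PicardNumberThreePowPrime.lean`) and the prime-power levels (`PicardNumberPrimePower.lean`); writing `560 = K·p` with `p` prime forces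
`K ∈ {80, 112, 280}`, none of them among those `K`. `decide +kernel` only (no `native_decide`).

HONEST FRAMING (cell `pub-hfermat`): explicit algebraic cycles for specific Hodge classes on Fermat/Delsarte varieties; residual open
instances listed; no claim on general Hodge. These classes are algebraic (Lefschetz (1,1)); certified here is only the emptiness of the
exceptional list at this level.

## References
* [MeyerNeutsch1981Fermatquadrupel] W. Meyer, W. Neutsch, *Fermatquadrupel*, Math. Ann. 256 (1981) 51–62, §2 p. 53, Tabelle 1 p. 54 (no row 560).
* [Shioda1982PicardFermat] T. Shioda, J. Fac. Sci. Univ. Tokyo IA 28 (1982) 725–734, table p. 727 (levels `≤ 180`), Prop. 4 (Q′) p. 729.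
* [Aoki1983] N. Aoki, Math. Ann. 266 (1983) 23–54, Thm. C.
-/

namespace Literature.AlgebraicGeometry.Shioda1982

open Literature.AlgebraicGeometry.HodgeTheory

set_option maxHeartbeats 0 in
/-- **The search at `N = 560` passes on the first entries `0 ≤ a < 8`** (part 1 of 21: 8 chunks, 211579 candidate
triples): every visited sorted quadruple of representatives there fails the Hodge test or is standard (`checkB`; `reps 560 = []`).
[cite: MeyerNeutsch1981Fermatquadrupel, §2 p. 53 ("alle Fermatquadrupel für N ≤ 614 ermittelt") and Tabelle 1 p. 54 (no row 560)]
[cite: Aoki1983, Thm. C] -/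
theorem checkB_fiveHundredSixty_partOne :
    ∀ p ∈ ([(0, 1), (1, 1), (2, 1), (3, 1), (4, 1), (5, 1), (6, 1), (7, 1)] : List (ℕ × ℕ)), checkB 560 p.1 p.2 = true := by
  intro p hp
  simp only [List.mem_cons, List.not_mem_nil, or_false] at hp
  rcases hp with rfl | rfl | rfl | rfl | rfl | rfl | rfl | rfl <;> decide +kernel

end Literature.AlgebraicGeometry.Shioda1982
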